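import Summits.BirchSwinnertonDyer.Rank1Residual.F1Sign2.OddBranchValuesAtTwo
import HarnessLib

/-!
# `OddBranchValueShadowsAtTwo` — Part 6 of the odd-branch series at `2` (g3): §9 consequences of the functional equation (Part 4) for
the values (Part 5) of the odd pair of an elliptic curve good-supersingular at `2` with `a₂ = 0`:
the DOUBLE zero `T² ∣ L♯₋` when `w(E^{(−1)}) = −w_E·χ₄(N) = +1` (`X_sq_dvd_oddSharp_of_sign`),
`4 ∣ L♯₋(−2)` i.e. `‖[1/8]⁻ − [5/8]⁻‖₂ < 1` when `w(E^{(−1)}) = +1 ∨ χ₈(N) = +1`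
(`norm_sub_ratMinusSymbol_eighth_lt_one`), `2 ∣ L♭₋(0)` i.e. `‖[1/4]⁻‖₂ ≤ 1` when `χ₈(N) = +1`
(`norm_ratMinusSymbol_quarter_le_one_of_chi8`), and the sign anchor `[1/4]⁻ = 0` when
`w(E^{(−1)}) = −1` (`ratMinusSymbol_quarter_eq_zero_of_sign`). See Part 1 for the overview.

TURNKEY filing by the typer seat `bsd-f1-sign2-ty` (D-ty-6, part 6/6 of -an g3's kernel file `OddFE.lean`
200de6ab6bb130d9, pre-split by the planner): `HOME/MEMO-an-data/g3/split/OddBranchValueShadowsAtTwo.lean` sha16 4d40d27b26ba4381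
(joint farm checks `JointA_parts1to4` 000c30d5de228c06 / `JointB_parts1to6` cbbe6a2064807d53: rc 0, 0 warnings, 0 sorries),
re-filed VERBATIM. PROOF-ONLY module (theorems; no definition, no named fact). REF2-PLACEMENT-v8 §0: the odd-branch
functional equation at 2 is IN PRINT (Sprung, ANT 11 (2017), Cor. 4.14 at (p, i) = (2, 1); Sprung arXiv:1211.1352 Thm 3.16 /
Cor 3.17) — formalised here, not new; beyond-print theorem: no for the FE itself; the value corollaries at `T = 0` / `T = −2` are the `T¹`/`T²`-coefficient
readings of the FE = IN-PRINT-ASSEMBLY per REF2-PLACEMENT-v9 §2–§3 (Dion–Sprung 2019, Thm. 5.1 and Thm. 4.1).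
[cite: DionSprung2019, Thm. 5.1 and Thm. 4.1] [cite: Sprung2017, Cor. 4.14]
-/

set_option autoImplicit false

noncomputable section

open scoped MatrixGroups ModularForm

open CongruenceSubgroup PowerSeries Filter Topology
  Literature.NumberTheory.EllipticCurves Literature.NumberTheory.EllipticCurves.ModularForms
  Literature.NumberTheory.EllipticCurves.Sprung2017 Literature.Barriers.BirchSwinnertonDyer

namespace Summit.BirchSwinnertonDyer.Rank1Residual.F1Sign2

/-! ## §9. Consequences of the functional equation for the values (elliptic curves, `a₂ = 0`)

With `s = −w_E χ₄(N) = w(E^{(−1)})`, `x♯ = c + a`, `x♭ = c + b` (`a` even, `b` odd in `ℤ₂`; `c` even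
iff `χ₈(N) = +1`, `neg_one_pow_val_eq_chi8`) and `B = binomialSeries x`, `B₀ = 1`, `B₁ = x`, the
coefficient identities of `G(ιT) = s·B·G` (`[T¹]G(ιT) = −g₁`, `[T²]G(ιT) = g₁ + g₂`) read
`[T⁰] g₀ = s g₀`, `[T¹] −g₁ = s(g₁ + x g₀)`, `[T²] g₁ + g₂ = s(g₂ + x g₁ + B₂ g₀)`. -/

section Coeff

variable {R : Type*} [CommRing R]

/-- `[T⁰] g(ιT) = g₀`. [folklore] -/
theorem coeff_zero_subst_invOnePlusSubOne (g : R⟦X⟧) :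
    coeff 0 (g.subst (invOnePlusSubOne : R⟦X⟧)) = coeff 0 g := by
  have hι : constantCoeff (invOnePlusSubOne : R⟦X⟧) = 0 := constantCoeff_invOnePlusSubOne
  rw [coeff_subst' (HasSubst.of_constantCoeff_zero' hι), finsum_eq_single _ 0]
  · rw [pow_zero, coeff_one, if_pos rfl, smul_eq_mul, mul_one]
  · intro d hd
    rw [coeff_of_lt_order 0 (lt_of_lt_of_le (by exact_mod_cast Nat.pos_of_ne_zero hd)
      (natCast_le_order_pow hι d)), smul_zero]

/-- `[T⁰](B·g) = B₀g₀`. [folklore] -/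
theorem coeff_zero_mul' (B g : R⟦X⟧) : coeff 0 (B * g) = coeff 0 B * coeff 0 g := by
  simp only [coeff_zero_eq_constantCoeff_apply, map_mul]

end Coeff

section CurveValues

open Summit.BirchSwinnertonDyer.Rank1Residual.Supersingular
  Summit.BirchSwinnertonDyer.Rank1Residual.F1Sign2

/-- `χ₄(N) = ±1` for odd `N`. [folklore] -/
theorem chi4_natCast_eq_one_or_of_odd {N : ℕ} (hN : ¬ 2 ∣ N) :
    ZMod.χ₄ (N : ZMod 4) = 1 ∨ ZMod.χ₄ (N : ZMod 4) = -1 := by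
  rw [ZMod.χ₄_nat_eq_if_mod_four]
  have h2 : N % 2 ≠ 0 := fun h ↦ hN (Nat.dvd_of_mod_eq_zero h)
  rw [if_neg h2]
  split_ifs <;> simp

/-- `w_E χ₄(N_E) = ±1` (`2 ∤ N_E`). [folklore] -/
theorem rootNumber_mul_chi4_eq_one_or {W : WeierstrassCurve ℚ} (hN : ¬ 2 ∣ W.conductorNorm ℤ) :
    W.rootNumber * ZMod.χ₄ (W.conductorNorm ℤ : ZMod 4) = 1 ∨
      W.rootNumber * ZMod.χ₄ (W.conductorNorm ℤ : ZMod 4) = -1 := by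
  rcases W.rootNumber_eq_one_or with hw | hw <;>
    rcases chi4_natCast_eq_one_or_of_odd hN with hχ | hχ <;> simp [hw, hχ]

variable {W : WeierstrassCurve ℚ} [W.IsElliptic] [W.IsGloballyMinimal] [NeZero (W.conductorNorm ℤ)]
  {f : CuspForm (Gamma0 (W.conductorNorm ℤ)) 2}

/-- The exponent `c` of `N = η 5^c` is even when `χ₈(N) = +1`. [folklore] -/
private theorem two_dvd_exponent_of_chi8 {M : ℕ} {ηN : rootsOfUnity (torsionOrder 2) ℤ_[2]} {c : ℤ_[2]}
    (hc : ∀ n : ℕ, PadicInt.toZModPow (n + cyclotomicExponent 2) ((ηN : ℤ_[2]ˣ) : ℤ_[2]) *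
      (cyclotomicGenerator 2 : ZMod (2 ^ (n + cyclotomicExponent 2))) ^
        (PadicInt.toZModPow n c).val = (M : ZMod (2 ^ (n + cyclotomicExponent 2))))
    (hχ : ZMod.χ₈ (M : ZMod 8) = 1) : (2 : ℤ_[2]) ∣ c := by
  have hpar := neg_one_pow_val_eq_chi8 (N := M) (n := 1) le_rfl (hc 1)
  rw [hχ] at hpar
  have hval : (PadicInt.toZModPow 1 c).val = 0 := by
    have hlt : (PadicInt.toZModPow 1 c).val < 2 := by
      simpa using (PadicInt.toZModPow 1 c).val_lt
    rcases Nat.lt_or_ge (PadicInt.toZModPow 1 c).val 1 with h | h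
    · omega
    · exfalso
      have h1 : (PadicInt.toZModPow 1 c).val = 1 := by omega
      rw [h1, pow_one] at hpar
      norm_num at hpar
  have hker : c ∈ RingHom.ker (PadicInt.toZModPow (p := 2) 1) := by
    rw [RingHom.mem_ker]; exact (ZMod.val_eq_zero _).mp hval
  rw [PadicInt.ker_toZModPow, Ideal.mem_span_singleton, pow_one] at hker
  exact hker

/-- **The coefficient identities of the ♯ functional equation (`a₂ = 0`)**: `ℓ₀ = 0`, and for the data
`N = η 5^c`, `3a = −2` of `exists_teichmuller_exponent_natCast` / `exists_three_mul_eq`: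
`−ℓ₁ = s ℓ₁` and `ℓ₁ + ℓ₂ = s(ℓ₂ + (c+a)ℓ₁)` with `s = −w_E χ₄(N)`. -/
private theorem oddSharp_coeff_eqs (hf : IsNewformOf W f) (hgood : W.HasGoodReductionAtPrime 2)
    (ha0 : W.frobeniusTrace 2 = 0) {Ls Lf : IwasawaAlgebra 2} (hSP : IsSprungPairOdd f 2 0 Ls Lf) :
    coeff 0 Ls = 0 ∧
    ∃ (ηN : rootsOfUnity (torsionOrder 2) ℤ_[2]) (c a : ℤ_[2]),
      (∀ n : ℕ, PadicInt.toZModPow (n + cyclotomicExponent 2) ((ηN : ℤ_[2]ˣ) : ℤ_[2]) *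
          (cyclotomicGenerator 2 : ZMod (2 ^ (n + cyclotomicExponent 2))) ^
            (PadicInt.toZModPow n c).val =
              (W.conductorNorm ℤ : ZMod (2 ^ (n + cyclotomicExponent 2)))) ∧
      3 * a = -2 ∧
      -coeff 1 Ls =
        (((-(W.rootNumber * ZMod.χ₄ (W.conductorNorm ℤ : ZMod 4))) : ℤ) : ℤ_[2]) * coeff 1 Ls ∧
      coeff 1 Ls + coeff 2 Ls =
        (((-(W.rootNumber * ZMod.χ₄ (W.conductorNorm ℤ : ZMod 4))) : ℤ) : ℤ_[2]) *
          (coeff 2 Ls + (c + a) * coeff 1 Ls) := by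
  have hN2 : ¬ 2 ∣ W.conductorNorm ℤ := not_dvd_level_of_isNewformOf hf hgood
  have hap : cuspCoeff f 2 = ((0 : ℤ) : ℂ) := by
    rw [cuspCoeff_eq_frobeniusTrace_of_isNewformOf_holds hf hgood, ha0]
  have h0 : coeff 0 Ls = 0 := by
    rw [coeff_zero_eq_constantCoeff_apply]
    exact constantCoeff_oddSharp_eq_zero f hSP hf.1 hf.coeffField_eq_bot hN2 hap
  obtain ⟨ηN, c, hc⟩ := exists_teichmuller_exponent_natCast 2 hN2
  obtain ⟨a, ha⟩ := exists_three_mul_eq (-2)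
  obtain ⟨b, hb⟩ := exists_three_mul_eq (-1)
  obtain ⟨hFEs, -⟩ :=
    subst_invOnePlusSubOne_eq_rootNumber_chi4_of_isSprungPairOdd_two hf hgood hc ha hb hSP
  refine ⟨h0, ηN, c, a, hc, ha, ?_⟩
  set s : ℤ := -(W.rootNumber * ZMod.χ₄ (W.conductorNorm ℤ : ZMod 4)) with hs_def
  set B : IwasawaAlgebra 2 := PowerSeries.binomialSeries ℤ_[2] (c + a) with hB
  have hB0 : coeff 0 B = 1 := by
    rw [hB, PowerSeries.binomialSeries_coeff, Ring.choose_zero_right, one_smul]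
  have hB1 : coeff 1 B = c + a := by
    rw [hB, PowerSeries.binomialSeries_coeff, Ring.choose_one_right, smul_eq_mul, mul_one]
  have hσC : ((s : ℤ) : IwasawaAlgebra 2) = C ((s : ℤ) : ℤ_[2]) := by rw [map_intCast]
  rw [hσC, mul_assoc] at hFEs
  have E1 := congrArg (coeff 1) hFEs
  rw [coeff_one_subst_invOnePlusSubOne, coeff_C_mul, coeff_one_mul', hB0, hB1, one_mul, h0,
    mul_zero, add_zero] at E1
  have E2 := congrArg (coeff 2) hFEs
  rw [coeff_two_subst_invOnePlusSubOne, coeff_C_mul, coeff_two_mul', hB0, hB1, one_mul, h0,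
    mul_zero, add_zero] at E2
  exact ⟨E1, E2⟩

/-- **AN-6 double zero.** If `w_E χ₄(N_E) = −1`, i.e. `w(E^{(−1)}) = +1`, then `ℓ₁ = 0`: the ♯
functional equation has sign `+1` and `[T¹]` gives `−ℓ₁ = ℓ₁`. With `ℓ₀ = 0` (`a₂ = 0`): `T² ∣ L♯₋`.
So when `E^{(−1)}` has EVEN analytic rank the forced zero of `L♯₋` at `χ₋₄` is at least double
(MEMO-an AN-6 predicts the exact order `|r₋₁ − 1| + 1`, `= 2` for `r₋₁ = 1`… here `r₋₁` even).
[cite: Sprung2017, Cor. 4.4, Cor. 4.14 (shape)] [cite: GreenbergLNM1716, §1] -/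
theorem coeff_one_oddSharp_eq_zero_of_sign (hf : IsNewformOf W f)
    (hgood : W.HasGoodReductionAtPrime 2) (ha0 : W.frobeniusTrace 2 = 0)
    (hs : W.rootNumber * ZMod.χ₄ (W.conductorNorm ℤ : ZMod 4) = -1)
    {Ls Lf : IwasawaAlgebra 2} (hSP : IsSprungPairOdd f 2 0 Ls Lf) : coeff 1 Ls = 0 := by
  obtain ⟨-, ηN, c, a, -, -, E1, -⟩ := oddSharp_coeff_eqs hf hgood ha0 hSP
  rw [hs] at E1
  push_cast at E1
  have h2 : (2 : ℤ_[2]) * coeff 1 Ls = 0 := by linear_combination -E1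
  exact (mul_eq_zero.mp h2).resolve_left two_ne_zero

/-- **`T² ∣ L♯₋` when `a₂(E) = 0` and `w(E^{(−1)}) = +1`.** [cite: Sprung2017, Cor. 4.4, Cor. 4.14 (shape)] -/
theorem X_sq_dvd_oddSharp_of_sign (hf : IsNewformOf W f)
    (hgood : W.HasGoodReductionAtPrime 2) (ha0 : W.frobeniusTrace 2 = 0)
    (hs : W.rootNumber * ZMod.χ₄ (W.conductorNorm ℤ : ZMod 4) = -1)
    {Ls Lf : IwasawaAlgebra 2} (hSP : IsSprungPairOdd f 2 0 Ls Lf) :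
    (PowerSeries.X : IwasawaAlgebra 2) ^ 2 ∣ Ls := by
  rw [PowerSeries.X_pow_dvd_iff]
  intro m hm
  interval_cases m
  · exact (oddSharp_coeff_eqs hf hgood ha0 hSP).1
  · exact coeff_one_oddSharp_eq_zero_of_sign hf hgood ha0 hs hSP

/-- **`2 ∣ ℓ₁`** when `w(E^{(−1)}) = +1` (then `ℓ₁ = 0`) or `χ₈(N) = +1` (then, in the remaining case
`s = −1`, `[T²]` gives `ℓ₁ = −2ℓ₂ − (c+a)ℓ₁` with `c + a` even). [cite: Sprung2017, Cor. 4.4, Cor. 4.14 (shape)] -/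
theorem two_dvd_coeff_one_oddSharp (hf : IsNewformOf W f)
    (hgood : W.HasGoodReductionAtPrime 2) (ha0 : W.frobeniusTrace 2 = 0)
    (h : W.rootNumber * ZMod.χ₄ (W.conductorNorm ℤ : ZMod 4) = -1 ∨
      ZMod.χ₈ (W.conductorNorm ℤ : ZMod 8) = 1)
    {Ls Lf : IwasawaAlgebra 2} (hSP : IsSprungPairOdd f 2 0 Ls Lf) :
    (2 : ℤ_[2]) ∣ coeff 1 Ls := by
  by_cases hs : W.rootNumber * ZMod.χ₄ (W.conductorNorm ℤ : ZMod 4) = -1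
  · rw [coeff_one_oddSharp_eq_zero_of_sign hf hgood ha0 hs hSP]; exact dvd_zero 2
  have hχ : ZMod.χ₈ (W.conductorNorm ℤ : ZMod 8) = 1 := h.resolve_left hs
  obtain ⟨-, ηN, c, a, hc, ha, -, E2⟩ := oddSharp_coeff_eqs hf hgood ha0 hSP
  have hN2 : ¬ 2 ∣ W.conductorNorm ℤ := not_dvd_level_of_isNewformOf hf hgood
  have hs1 : W.rootNumber * ZMod.χ₄ (W.conductorNorm ℤ : ZMod 4) = 1 :=
    (rootNumber_mul_chi4_eq_one_or hN2).resolve_right hs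
  obtain ⟨c', hc'⟩ := two_dvd_exponent_of_chi8 hc hχ
  have ha' : a = 2 * (-1 - a) := by linear_combination ha
  have hxy : c + a = 2 * (c' + (-1 - a)) := by rw [hc', mul_add, ← ha']
  rw [hxy, hs1] at E2
  push_cast at E2
  exact ⟨-(coeff 2 Ls) - (c' + (-1 - a)) * coeff 1 Ls, by linear_combination E2⟩

/-- **AN-9V2: `4 ∣ L♯₋(−2)`** for every odd pair, when `a₂(E) = 0` and (`w(E^{(−1)}) = +1` or
`χ₈(N) = +1`): `L♯₋(−2) = ℓ₀ − 2ℓ₁ + 4r` with `ℓ₀ = 0`, `2 ∣ ℓ₁`. (A priori only `2 ∣ L♯₋(−2)`.)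
[cite: Sprung2017, Cor. 4.4, Cor. 4.14 (shape)] -/
theorem four_dvd_evalAt_oddSharp_neg_two (hf : IsNewformOf W f)
    (hgood : W.HasGoodReductionAtPrime 2) (ha0 : W.frobeniusTrace 2 = 0)
    (h : W.rootNumber * ZMod.χ₄ (W.conductorNorm ℤ : ZMod 4) = -1 ∨
      ZMod.χ₈ (W.conductorNorm ℤ : ZMod 8) = 1)
    {Ls Lf : IwasawaAlgebra 2} (hSP : IsSprungPairOdd f 2 0 Ls Lf) :
    (4 : ℤ_[2]) ∣ BlindLever.evalAt (-2 : ℤ_[2]) Ls := by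
  obtain ⟨k, hk⟩ := two_dvd_coeff_one_oddSharp hf hgood ha0 h hSP
  have h0 : coeff 0 Ls = 0 := (oddSharp_coeff_eqs hf hgood ha0 hSP).1
  obtain ⟨r, hr⟩ := exists_evalAt_eq BlindLever.norm_neg_two_lt_one Ls
  rw [hr, h0, hk]
  exact ⟨-k + r, by ring⟩

/-- `‖2‖₂ = 2⁻¹`. -/
private theorem norm_two' : ‖(2 : ℚ_[2])‖ = 2⁻¹ := by exact_mod_cast @Padic.norm_p 2 _

/-- **AN-9V2 at symbol level: `‖[1/8]⁻_f − [5/8]⁻_f‖₂ < 1`** for the newform `f` of `E = W` with good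
reduction at `2`, `a₂(E) = 0`, and `w(E^{(−1)}) = +1` or `χ₈(N_E) = +1` — i.e. the `χ₋₈`-twisted
central symbol `([1/8]⁻ − [3/8]⁻ − [5/8]⁻ + [7/8]⁻)/2 = [1/8]⁻ − [5/8]⁻` (the `E^{(−2)}`-value in
`[·]⁻` units, a priori of norm `≤ 2`) is `2`-ADICALLY NON-UNIT. Content case: `w(E^{(−1)}) = +1` and
`χ₈(N) = +1` (then `w(E^{(−2)}) = +1` too); in the other covered cases `w(E^{(−2)}) = −1` and the
symbol vanishes classically. From `four_dvd_evalAt_oddSharp_neg_two` + `coe_evalAt_oddSharp_neg_two_eq`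
for the pair `exists_isSprungPairOdd_two`. [cite: Sprung2017, Thm. 1.12, Cor. 4.4, Cor. 4.14]
[cite: MazurTateTeitelbaum1986Invent, §I.13, §I.17] -/
theorem norm_sub_ratMinusSymbol_eighth_lt_one (hf : IsNewformOf W f)
    (hgood : W.HasGoodReductionAtPrime 2) (ha0 : W.frobeniusTrace 2 = 0)
    (h : W.rootNumber * ZMod.χ₄ (W.conductorNorm ℤ : ZMod 4) = -1 ∨
      ZMod.χ₈ (W.conductorNorm ℤ : ZMod 8) = 1) :
    ‖((ratMinusSymbol f ((1 : ℚ) / 8) - ratMinusSymbol f ((5 : ℚ) / 8) : ℚ) : ℚ_[2])‖ < 1 := by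
  have ha : (2 : ℤ) ∣ W.frobeniusTrace 2 := by rw [ha0]; exact dvd_zero 2
  obtain ⟨Ls, Lf, hSP⟩ := exists_isSprungPairOdd_two hf hgood ha
  rw [ha0] at hSP
  have hN2 : ¬ 2 ∣ W.conductorNorm ℤ := not_dvd_level_of_isNewformOf hf hgood
  have h4 : ¬ 4 ∣ W.conductorNorm ℤ := fun h4 ↦ hN2 (dvd_trans (by norm_num) h4)
  have hreal : ∀ n, (cuspCoeff f n).im = 0 :=
    cuspCoeff_im_eq_zero_of_coeffField_eq_bot hf.coeffField_eq_bot
  have hcoe := coe_evalAt_oddSharp_neg_two_eq f hreal h4 hSP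
  obtain ⟨k, hk⟩ := four_dvd_evalAt_oddSharp_neg_two hf hgood ha0 h hSP
  have hk4 : ((BlindLever.evalAt (-2 : ℤ_[2]) Ls : ℤ_[2]) : ℚ_[2]) = 4 * (k : ℚ_[2]) := by
    rw [hk]; push_cast [PadicInt.coe_mul]; rfl
  rw [hk4] at hcoe
  have hS : ((ratMinusSymbol f ((1 : ℚ) / 8) - ratMinusSymbol f ((5 : ℚ) / 8) : ℚ) : ℚ_[2]) =
      -2 * (k : ℚ_[2]) := by
    push_cast at hcoe ⊢
    linear_combination ((1 : ℚ_[2]) / 2) * hcoe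
  have hk1 : ‖(k : ℚ_[2])‖ ≤ 1 := PadicInt.norm_le_one k
  rw [hS, norm_mul, norm_neg, norm_two']
  calc (2 : ℝ)⁻¹ * ‖(k : ℚ_[2])‖ ≤ (2 : ℝ)⁻¹ * 1 := by gcongr
    _ < 1 := by norm_num

/-- **Sign anchor (classical shadow): `w(E^{(−1)}) = −1 ⇒ [1/4]⁻_f = 0`**, i.e. `L♭₋(0) = 0`: the ♭
functional equation with sign `s = −1` at `[T⁰]` gives `m₀ = −m₀`, and `m₀ = −2[1/4]⁻`
(`coe_constantCoeff_oddFlat_eq`). (`2[1/4]⁻ = [1/4]⁻ − [3/4]⁻ ∝ L(E^{(−1)}, 1)`, which vanishes when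
`w(E^{(−1)}) = −1` — this is the cheap check of the sign convention `s = −w_Eχ₄(N)`.)
[cite: Sprung2017, Cor. 4.4, Cor. 4.14 (shape)] [cite: MazurTateTeitelbaum1986Invent, §I.13, §I.17] -/
theorem ratMinusSymbol_quarter_eq_zero_of_sign (hf : IsNewformOf W f)
    (hgood : W.HasGoodReductionAtPrime 2) (ha0 : W.frobeniusTrace 2 = 0)
    (hs : W.rootNumber * ZMod.χ₄ (W.conductorNorm ℤ : ZMod 4) = 1) :
    ratMinusSymbol f (1 / 4) = 0 := by
  have ha2 : (2 : ℤ) ∣ W.frobeniusTrace 2 := by rw [ha0]; exact dvd_zero 2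
  obtain ⟨Ls, Lf, hSP⟩ := exists_isSprungPairOdd_two hf hgood ha2
  rw [ha0] at hSP
  have hN2 : ¬ 2 ∣ W.conductorNorm ℤ := not_dvd_level_of_isNewformOf hf hgood
  obtain ⟨ηN, c, hc⟩ := exists_teichmuller_exponent_natCast 2 hN2
  obtain ⟨a, ha⟩ := exists_three_mul_eq (-2)
  obtain ⟨b, hb⟩ := exists_three_mul_eq (-1)
  obtain ⟨-, hFEf⟩ :=
    subst_invOnePlusSubOne_eq_rootNumber_chi4_of_isSprungPairOdd_two hf hgood hc ha hb hSP
  rw [hs] at hFEf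
  have hσC : ((-(1 : ℤ) : ℤ) : IwasawaAlgebra 2) = C (-1 : ℤ_[2]) := by
    rw [map_neg, map_one, Int.cast_neg, Int.cast_one]
  rw [hσC, mul_assoc] at hFEf
  have E0 := congrArg (coeff 0) hFEf
  rw [coeff_zero_subst_invOnePlusSubOne, coeff_C_mul, coeff_zero_mul', PowerSeries.binomialSeries_coeff,
    Ring.choose_zero_right, one_smul, one_mul] at E0
  -- `m₀ = −m₀`
  have hm0 : coeff 0 Lf = 0 := by
    have h2 : (2 : ℤ_[2]) * coeff 0 Lf = 0 := by linear_combination E0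
    exact (mul_eq_zero.mp h2).resolve_left two_ne_zero
  have hcoe := coe_constantCoeff_oddFlat_eq f hSP
  rw [← coeff_zero_eq_constantCoeff_apply, hm0, PadicInt.coe_zero] at hcoe
  have h' : ((ratMinusSymbol f (1 / 4) : ℚ) : ℚ_[2]) = 0 := by
    linear_combination ((1 : ℚ_[2]) / 2) * hcoe
  exact_mod_cast h'

/-- **AN-9V1: `2 ∣ L♭₋(0)`** for every odd pair of weight `a₂ = 0`, when `χ₈(N_E) = +1`: if `s = −1`
then `m₀ = 0`; if `s = +1`, `[T¹]` of the ♭ equation gives `−m₁ = m₁ + (c+b)m₀` with `c + b` ODD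
(`c` even, `b = −1/3` odd), so `m₀ = −2m₁ − (c+b−1)m₀ ∈ 2ℤ₂`. [cite: Sprung2017, Cor. 4.4, Cor. 4.14 (shape)] -/
theorem two_dvd_constantCoeff_oddFlat_of_chi8 (hf : IsNewformOf W f)
    (hgood : W.HasGoodReductionAtPrime 2) (hχ : ZMod.χ₈ (W.conductorNorm ℤ : ZMod 8) = 1)
    {Ls Lf : IwasawaAlgebra 2} (hSP : IsSprungPairOdd f 2 0 Ls Lf) :
    (2 : ℤ_[2]) ∣ PowerSeries.constantCoeff Lf := by
  have hN2 : ¬ 2 ∣ W.conductorNorm ℤ := not_dvd_level_of_isNewformOf hf hgood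
  obtain ⟨ηN, c, hc⟩ := exists_teichmuller_exponent_natCast 2 hN2
  obtain ⟨a, ha⟩ := exists_three_mul_eq (-2)
  obtain ⟨b, hb⟩ := exists_three_mul_eq (-1)
  obtain ⟨-, hFEf⟩ :=
    subst_invOnePlusSubOne_eq_rootNumber_chi4_of_isSprungPairOdd_two hf hgood hc ha hb hSP
  set s : ℤ := -(W.rootNumber * ZMod.χ₄ (W.conductorNorm ℤ : ZMod 4)) with hs_def
  set B : IwasawaAlgebra 2 := PowerSeries.binomialSeries ℤ_[2] (c + b) with hB
  have hB0 : coeff 0 B = 1 := by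
    rw [hB, PowerSeries.binomialSeries_coeff, Ring.choose_zero_right, one_smul]
  have hB1 : coeff 1 B = c + b := by
    rw [hB, PowerSeries.binomialSeries_coeff, Ring.choose_one_right, smul_eq_mul, mul_one]
  have hσC : ((s : ℤ) : IwasawaAlgebra 2) = C ((s : ℤ) : ℤ_[2]) := by rw [map_intCast]
  rw [hσC, mul_assoc] at hFEf
  have E0 := congrArg (coeff 0) hFEf
  rw [coeff_zero_subst_invOnePlusSubOne, coeff_C_mul, coeff_zero_mul', hB0, one_mul] at E0
  have E1 := congrArg (coeff 1) hFEf
  rw [coeff_one_subst_invOnePlusSubOne, coeff_C_mul, coeff_one_mul', hB0, hB1, one_mul] at E1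
  rw [← coeff_zero_eq_constantCoeff_apply]
  rcases rootNumber_mul_chi4_eq_one_or hN2 with h1 | h1
  · -- `s = −1`: `m₀ = −m₀`
    have hs' : s = -1 := by rw [hs_def, h1]
    rw [hs'] at E0
    push_cast at E0
    refine ⟨0, ?_⟩
    have h2 : (2 : ℤ_[2]) * coeff 0 Lf = 2 * 0 := by linear_combination E0
    linear_combination mul_left_cancel₀ two_ne_zero h2
  · -- `s = +1`: `−m₁ = m₁ + (c+b)m₀`, `c + b = 2y + 1`
    have hs' : s = 1 := by rw [hs_def, h1]; norm_num
    rw [hs'] at E1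
    push_cast at E1
    obtain ⟨c', hc'⟩ := two_dvd_exponent_of_chi8 hc hχ
    have hb' : b = 2 * (-b - 1) + 1 := by linear_combination hb
    have hxy : c + b = 2 * (c' + (-b - 1)) + 1 := by rw [hc']; linear_combination hb
    rw [hxy] at E1
    exact ⟨-(coeff 1 Lf) - (c' + (-b - 1)) * coeff 0 Lf, by linear_combination -E1⟩

/-- **AN-9V1 at symbol level: `‖[1/4]⁻_f‖₂ ≤ 1`** for the newform `f` of `E = W` with good reduction at
`2`, `a₂(E) = 0` and `χ₈(N_E) = +1` (a priori `‖[1/4]⁻‖₂ ≤ 2`): the `χ₋₄`-twisted central symbol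
`2[1/4]⁻ = [1/4]⁻ − [3/4]⁻` (the `E^{(−1)}`-value in `[·]⁻` units) is divisible by `2`. Content case
`w(E^{(−1)}) = +1`; for `w(E^{(−1)}) = −1` it vanishes (`ratMinusSymbol_quarter_eq_zero_of_sign`).
[cite: Sprung2017, Thm. 1.12, Cor. 4.4, Cor. 4.14] [cite: MazurTateTeitelbaum1986Invent, §I.13, §I.17] -/
theorem norm_ratMinusSymbol_quarter_le_one_of_chi8 (hf : IsNewformOf W f)
    (hgood : W.HasGoodReductionAtPrime 2) (ha0 : W.frobeniusTrace 2 = 0)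
    (hχ : ZMod.χ₈ (W.conductorNorm ℤ : ZMod 8) = 1) :
    ‖((ratMinusSymbol f (1 / 4) : ℚ) : ℚ_[2])‖ ≤ 1 := by
  have ha2 : (2 : ℤ) ∣ W.frobeniusTrace 2 := by rw [ha0]; exact dvd_zero 2
  obtain ⟨Ls, Lf, hSP⟩ := exists_isSprungPairOdd_two hf hgood ha2
  rw [ha0] at hSP
  have hcoe := coe_constantCoeff_oddFlat_eq f hSP
  obtain ⟨k, hk⟩ := two_dvd_constantCoeff_oddFlat_of_chi8 hf hgood hχ hSP
  have hk2 : ((PowerSeries.constantCoeff Lf : ℤ_[2]) : ℚ_[2]) = 2 * (k : ℚ_[2]) := by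
    rw [hk]; push_cast [PadicInt.coe_mul]; rfl
  rw [hk2] at hcoe
  have hS : ((ratMinusSymbol f (1 / 4) : ℚ) : ℚ_[2]) = -(k : ℚ_[2]) := by
    linear_combination ((1 : ℚ_[2]) / 2) * hcoe
  rw [hS, norm_neg]
  exact PadicInt.norm_le_one k

end CurveValues

end Summit.BirchSwinnertonDyer.Rank1Residual.F1Sign2

end
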